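import Summits.FinalStateConjecture.FinalStateConjecture.Theses.ExactKerrEnds
import Literature.Geometry.Lorentzian.ExactKerrEnd
import Literature.Geometry.Lorentzian.TameBreathingCurve
import Literature.Geometry.Lorentzian.TameFamilyFarSurgery
import Literature.Geometry.Lorentzian.TameGenericityLocalWindowImmersed

/-! # Sketch (crux-strategist s2) — first lemmas of stub GU (`stub_gaugeBorneUpgrade`) of line
`wall-cone-sections` for `ExactKerrEnds.SettlingAlongCensoredKerrEnds` (stmt-FinalStateConjecture-18520).

The GAUGED FAMILY of a tame curve `H` through `d = H 0`: `F' c := (breathe (σ (c 0)))^* (H (ρ c))`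
with the quadratic reparametrisation `ρ c := (c 0)² • e₀` (so `ρ c ≠ 0` for `c ≠ 0`, `fderiv ρ 0 = 0`).
Signatures only (sorried) + the provable composition GU-from-the-four-lemmas; everything elaborates.
All ingredients are landed: `AFEnd.contMDiff_breatheFamily_family_h/k` (joint smoothness with
parameters), `IsStronglyAsymptoticallyFlatDR.congr_of_eqOn_far` + `isStronglyAsymptoticallyFlatDR_restrict_iff`
(decay of members agreeing with `H (ρ c)` off the core), `wDist_restrict_eq` + `wDist_triangle` +
`tendsto_iSup_weight_iteratedFDeriv_sub_nhds_zero` (wDist-continuity), `breatheFamily_h_inner_center`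
+ `contDiff_h_inner_line` (immersion marker), `mem_admissibleVacuumData_of_agree_off_compact` +
`isVacuumConstraintSolution_breatheFamily` (admissibility), `Theorems.ExactKerrEnds.settled_comap_iff`
(settledness transport; re-prove locally if FromSummit.lean is temporarily broken by the rev-5 `closes`
arity change), `exists_tameCurve_of_localWindow` (injectivity for free). -/

noncomputable section
set_option linter.dupNamespace false
open Set Function Filter Topology
open scoped Manifold ContDiff ENNReal
open Literature.Geometry.Lorentzian

namespace Summit.FinalStateConjecture.FinalStateConjecture.Cruxes.SettlingAlongCensoredKerrEnds.StrategistS2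

variable {X : Type} [TopologicalSpace X] [ChartedSpace E3 X] [IsManifold (𝓡 3) ∞ X] [T2Space X]

/-- The settling clause of the Statement for EVERY maximal development of `D` (verbatim the crux's
let-bound legend `Settled`; same as `IdeasK2.Settled`). -/
def Settled {X : Type} [TopologicalSpace X] [ChartedSpace E3 X] [IsManifold (𝓡 3) ∞ X]
    [ConnectedSpace X] (D : InitialDataSet (𝓡 3) X) : Prop :=
  ∀ 𝒟 : VacuumCauchyDevelopment D, 𝒟.IsMaximal →
    Summit.FinalStateConjecture.HasCompleteNullInfinity 𝒟.toCauchyDevelopment ∧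
      ∃ (O : Set 𝒟.carrier) (d : FinalStateDecomposition 𝒟.toSpacetime O 2),
        (∀ i, Kerr.IsSubextremal (d.mass i) (d.spin i)) ∧
          O = Summit.FinalStateConjecture.exteriorOf 𝒟.toCauchyDevelopment d.charted ∧
            Summit.FinalStateConjecture.RaysStayInClosure 𝒟.toCauchyDevelopment O ∧
              Summit.FinalStateConjecture.HasExhaustiveCharts d ∧
                Summit.FinalStateConjecture.IsFutureOriented d

/-- The quadratic reparametrisation `ρ c = (c 0)² • e₀` of `ℝ¹`. -/
def quadParam (c : EuclideanSpace ℝ (Fin 1)) : EuclideanSpace ℝ (Fin 1) :=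
  ((c 0) ^ 2) • EuclideanSpace.single 0 (1 : ℝ)

/-- **The gauged family** `F' c := E_{c 0} (H (ρ c)) = (breathe (σ (c 0)))^* (H ((c 0)² • e₀))`. -/
def gaugedFamily {e : AFEnd X} {z₀ : E3} {r : ℝ} (B : AFEnd.BreathingData e z₀ r)
    (H : EuclideanSpace ℝ (Fin 1) → InitialDataSet (𝓡 3) X) (c : EuclideanSpace ℝ (Fin 1)) :
    InitialDataSet (𝓡 3) X :=
  AFEnd.breatheFamily B (H (quadParam c)) (c 0)

variable {e : AFEnd X} {z₀ : E3} {r : ℝ} (B : AFEnd.BreathingData e z₀ r)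
  (H : EuclideanSpace ℝ (Fin 1) → InitialDataSet (𝓡 3) X)

/-- GU-1 (M): the gauged family passes through `H 0` and is jointly smooth
(`AFEnd.contMDiff_breatheFamily_family_h/k` with `pr = quadParam`, `τ = proj 0`). -/
theorem isSmoothDataFamily_gaugedFamily (hH : InitialDataSet.IsSmoothDataFamily 1 H) :
    gaugedFamily B H 0 = H 0 ∧ InitialDataSet.IsSmoothDataFamily 1 (gaugedFamily B H) := by
  sorry

/-- GU-2 (M/L): the gauged family of a TAME curve is tame on the collared end `e.restrict _`
(members agree with `H (ρ c)` off the compact breathing core: decay by `congr_of_eqOn_far`, mass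
`c ↦ M (ρ c)`; `wDist → 0` by the triangle inequality through `H (ρ c)`). -/
theorem isTameDataFamily_restrict_gaugedFamily (hH : InitialDataSet.IsTameDataFamily e 1 H)
    {R₁ : ℝ} (hR₁ : e.R < R₁) (hz : R₁ + r ≤ ‖z₀‖) :
    InitialDataSet.IsTameDataFamily (e.restrict hR₁.le) 1 (gaugedFamily B H) := by
  sorry

/-- GU-3 (M): the gauged family is IMMERSED at `0` — the marker `c ↦ h_{F' c}(x₀)(v₀, v₀) =
(1 + σ (c 0))² · h_{H (ρ c)}(x₀)(v₀, v₀)` has derivative `2 σ'(0) h_{H 0}(x₀)(v₀, v₀) ≠ 0` at `0`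
(the second factor is `C^∞` in `c` with vanishing derivative at `0` because `fderiv quadParam 0 = 0`). -/
theorem isImmersedAtZero_gaugedFamily (hH : InitialDataSet.IsSmoothDataFamily 1 H) :
    InitialDataSet.IsImmersedAtZero 1 (gaugedFamily B H) := by
  sorry

/-- GU-4 (S/M): admissibility and settledness pass to the gauged members (diffeomorphism
pull-back agreeing off a compact set; `settled_comap_iff`). -/
theorem gaugedFamily_mem_and_settled [SecondCountableTopology X] [ConnectedSpace X]
    (hadm : ∀ c, H c ∈ admissibleVacuumData X) (hgood : ∀ c ≠ 0, Settled (H c)) :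
    (∀ c, gaugedFamily B H c ∈ admissibleVacuumData X) ∧ ∀ c ≠ 0, Settled (gaugedFamily B H c) := by
  sorry

/-- **GU from GU-1…GU-4** (the assembly a stub-worker lands last; here with the four lemmas as
hypotheses it is `exists_tameCurve_of_localWindow` — injectivity for free on a window). PROVED. -/
theorem gaugeBorneUpgrade_of_lemmas [SecondCountableTopology X] [ConnectedSpace X]
    {R₁ : ℝ} (hR₁ : e.R < R₁)
    (h1 : gaugedFamily B H 0 = H 0 ∧ InitialDataSet.IsSmoothDataFamily 1 (gaugedFamily B H))
    (h2 : InitialDataSet.IsTameDataFamily (e.restrict hR₁.le) 1 (gaugedFamily B H))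
    (h3 : InitialDataSet.IsImmersedAtZero 1 (gaugedFamily B H))
    (h4 : (∀ c, gaugedFamily B H c ∈ admissibleVacuumData X) ∧
      ∀ c ≠ 0, Settled (gaugedFamily B H c)) :
    ∃ (e' : AFEnd X) (F' : EuclideanSpace ℝ (Fin 1) → InitialDataSet (𝓡 3) X),
      InitialDataSet.IsTameDataFamily e' 1 F' ∧ F' 0 = H 0 ∧ Injective F' ∧
        InitialDataSet.IsImmersedAtZero 1 F' ∧ (∀ c, F' c ∈ admissibleVacuumData X) ∧
          ∀ c ≠ 0, Settled (F' c) := by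
  obtain ⟨F', hF', hF'0, hinj, himm, hadm', hgood'⟩ :=
    InitialDataSet.exists_tameCurve_of_localWindow (𝓓 := admissibleVacuumData X) (P := Settled)
      h2 h3 zero_lt_one (fun c _ ↦ h4.1 c) (fun c hc _ ↦ h4.2 c hc)
  exact ⟨e.restrict hR₁.le, F', hF', hF'0.trans h1.1, hinj, himm, hadm', hgood'⟩

end Summit.FinalStateConjecture.FinalStateConjecture.Cruxes.SettlingAlongCensoredKerrEnds.StrategistS2
end
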